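import Summits.QuantumFields.YangMills.Theorems.BalabanUVNodesN11PartCompatOfCouplings
import Summits.QuantumFields.YangMills.Theses.BalabanUVNodes

/-!
# DAG node N11 × K1⁷ — WHAT ANY PROOF OF `StabilityBAtRecordR13SepCoPH` MUST DELIVER: the record's §2 form ([III] Thm 1's conclusion) AT A RUN WHOSE LAST 𝐃-CUBE DOES NOT FIT THE
# TORUS — β-free, from the crux's OWN consequent (its printed one-sided window `B16.Thm1Printed` + its own window clause `∃ γ₁ > 0, ∀ γ ≤ γ₁, ∃ P, 1 ≤ P.K ∧ window γ P`)

HEADER — WORK-UNIT METADATA.  Cell `pub-ymgap`, YM-PLAN Track A (HUMAN RULING D-0062 ∕ D-0149 width seats), seat `pub-ymgap-dag-n11-w4` (g4; WIDTH SEAT 4 of 4 on NODE n11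
[B14]), route `BalabanUVNodes`, item K1⁷ `StabilityBAtRecordR13SepCoPH` = stmt-QuantumFields-20542 (helper lane, `--kind proof --supports 20542 --as helper`, count-neutral).
[I] = [Balaban1987RG1], [III] = [Balaban1988Convergent], [V] = [Balaban1989LargeFieldII].  Over this seat's p608879 `…N11PartCompatOfCouplings` (`sitesPerDir_zero_eq`), K0a's
`Node00/Record13PartCompatOfSize` (`Stage13Params.dCubeSide_le_of_partCompat₁₃`), `Node00.isRj_RkOfRecord` ((2.5)), and the route file (the crux decl BY NAME, as a HYPOTHESIS).

WHY THIS FILE.  This seat's g4 INTENT-1 (`…N11RunGuardIsCouplingFloor`) settled the run guard `PartCompat₁₃` as a floor on the last coupling and LOCATED that the ∀-window guard binder of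
the chain road's printed faces is unsatisfiable.  THIS FILE lifts the observation to the CRUX ITSELF, with no β-letter and no assumption on the basic cube beyond `1 ≤ M` (admissibility)
and `1 ≤ r` ((2.5)'s exponent; `r = 1` at every witness of record): the consequent of `StabilityBAtRecordR13SepCoPH` at `(θ, h)` contains (a) `B16.EndStatementBPrinted (datum θ h).C`,
whose first conjunct `B16.Thm1Printed` ([V] Thm 1, verbatim: «contained in an interval ]0, γ]») delivers the §2 form at EVERY run of the ONE-SIDED window `]0, γ₂]`, and (b) the window
clause «for every small `γ` some run of positive length lies in `]0, γ]`».  Taking `γ` below `min(γ₁, γ₂, e^{−L^m})`, (b) gives a run `P` with `0 < g_K ≤ γ < e^{−L^m}`, so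
`log g_K⁻² > 2L^m ≥ R` for any `R ∣`-compatible last cube (`L^K·M·R_K ∣ 2L^{m+K}` forces `R_K ≤ 2L^m`, while (2.5) gives `(log g_K⁻²)^r ≤ R_K`): the run is NOT partition-compatible at
its last level — and (a) says the record's §2 form `Sect2Form k` holds at every `k ≤ K` of THAT run.  Hence ★★★: ANY proof of K1⁷ (by any road) establishes [III] Thm 1's conclusion
for the record at a run excluded by print's standing assumption «all partitions are compatible» ([III] p. 257) — where no 𝐃_K-cube fits the torus and the tree's only N11 machinery (the
no-expansion 𝐓-step faces: cube cover `hcov`, run guard `hPC`; the proviso row `bg` is itself guarded) is silent.  LOCATED, count-neutral: nothing registered is denied; whether the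
record's §2 form is trivially true there (one-block lattice), false there, or whether the crux wants a floor on `g_K` in its window is the plan's ∕ def-T's ∕ the K1 lead's ∕ the
disprover's call.  (The same extraction applies verbatim to the Cor. 3 (2.50) half of `EndStatementBPrinted`.)

WHAT THIS FILE PROVES (0 `sorry`, 0 `def`; β-free ℕ∕ℝ bookkeeping + unpacking the crux's consequent; the crux enters only as a HYPOTHESIS of §3).
§1 ★★ `not_partCompat₁₃_top_of_window_lt_exp_neg_pow` (any θ with `1 ≤ M`, `1 ≤ r`: a run of length `K ≥ 1` in `]0, γ]`, `γ < e^{−L^m}`, is not `PartCompat₁₃` at `K`) ·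
   LOCATED-r `partCompat₁₃_of_r_eq_zero` (at `r = 0`, `M = L^a`: EVERY run is compatible up to every `n` with room `n + a ≤ m + K` — the complementary dodge).
§2 ★★★ `exists_incompatible_run_with_sect2Form_of_consequentBody` (θ : Stage13HParams F N, `h : Provisos₁₃SepCoPH`, `1 ≤ r`: the consequent BODY at `(θ, h)` ⇒ a run `P`, `1 ≤ P.K`,
   NOT `PartCompat₁₃` at `P.K`, with `Sect2Form k` for all `k ≤ P.K`).
§3 ★★★ `incompatibleRun_of_stabilityBAtRecordR13SepCoPH` (the ROUTE DECL BY NAME as hypothesis: for every inhabited family the θ it produces carries such a run whenever `1 ≤ θ.ν.r`).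

HONEST FRAMING.  Helper lane of K1⁷; count-neutral; the crux is a HYPOTHESIS here (§3), NOT proved, NOT refuted; nothing of [I]∕[III]∕[V] asserted.  N11 NOT discharged; K1⁷ NOT
closed; counts unmoved (typed 28∕28 · discharged 5∕27).  R4 closes only the conditional finite-𝕋⁴ rung `BalabanLadder.UV` of one programme at fixed `ε = L^{−K}` — NOT ℝ⁴, NOT OS, NOT
a mass gap, NOT Clay.  No `sorry`, `axiom`, `def`, `instance`, `notation`.  Sources (SHAPE ∕ bookkeeping only): [V] Thm 1 p.355; [III] (2.1) p.254, (2.5) p.255, p.257, Thm 1 p.262;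
[I] (0.1) p.251, Thm 1 p.259.
-/

noncomputable section

namespace Summit.QuantumFields.YangMills.Theorems.BalabanUVNodesN11K1ConsequentMeetsIncompatibleRuns

open Literature.MathematicalPhysics.QuantumFieldTheory.Balaban1983to89 T4Continuum Node00
open BalabanUVNodesN11PartCompatOfCouplings (sitesPerDir_zero_eq partCompat₁₃_of_log_pow_le)

/-! ## §1  β-free: in a window below `e^{−L^m}` no run of positive length is partition-compatible at its last level (any `M ≥ 1`, `r ≥ 1`) -/

section Generic

variable {F : T4Family} {N : ℕ} [NeZero N]

/-- **★★ BELOW `e^{−L^m}` THE LAST 𝐃-CUBE NEVER FITS** (any θ with `1 ≤ θ.τ9.M`, `1 ≤ θ.ν.r`): if the record's run `p` of length `K ≥ 1` lies in `]0, γ]` with `γ < exp(−L^m)`, then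
`PartCompat₁₃ θ p K` fails — compatibility at level `K` forces `L^K·M·R_K ≤ 2L^{m+K}`, i.e. `R_K ≤ 2L^m`, while (2.5) and the window give `R_K ≥ (log g_K⁻²)^r ≥ log g_K⁻² > 2L^m`.
[cite: Balaban1988Convergent, (2.1) p.254, (2.5) p.255, p.257; Balaban1987RG1, (0.1) p.251, Thm 1 p.259] -/
theorem not_partCompat₁₃_top_of_window_lt_exp_neg_pow (θ : Stage13Params F N) (hM : 1 ≤ θ.τ9.M) (hr : 1 ≤ θ.ν.r)
    (p : B12.RunParams) (hK : 1 ≤ p.K) {γ : ℝ} (hW : Step.InInterval γ p.K (gOfRecord₁₃ F N θ p))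
    (hγ : γ < Real.exp (-((F.L : ℝ) ^ F.m))) : ¬ PartCompat₁₃ F N θ p p.K := by
  intro h
  have hL2 : 2 ≤ F.L := by have := F.hL11; omega
  -- size: `L^K · M · R_K ≤ 2 · L^(m+K)`, hence `R_K ≤ 2 · L^m`
  have hsz := θ.dCubeSide_le_of_partCompat₁₃ p p.K h p.K hK le_rfl
  rw [sitesPerDir_zero_eq] at hsz
  simp only [T4Family.P_L, dCubeSide] at hsz
  set R := RkOfRecord F.L θ.ν.r (gOfRecord₁₃ F N θ p p.K) with hRdef
  have hR : R ≤ 2 * F.L ^ F.m := by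
    have hpos : 0 < F.L ^ p.K := by positivity
    have h1 : F.L ^ p.K * (θ.τ9.M * R) ≤ F.L ^ p.K * (2 * F.L ^ F.m) := by
      calc F.L ^ p.K * (θ.τ9.M * R) = F.L ^ p.K * θ.τ9.M * R := by ring
        _ ≤ 2 * F.L ^ (F.m + p.K) := hsz
        _ = F.L ^ p.K * (2 * F.L ^ F.m) := by rw [pow_add]; ring
    have h2 : θ.τ9.M * R ≤ 2 * F.L ^ F.m := Nat.le_of_mul_le_mul_left h1 hpos
    exact le_trans (Nat.le_mul_of_pos_left R hM) h2
  -- (2.5): `(log g_K⁻²)^r ≤ R_K`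
  obtain ⟨s, -, hle, -⟩ := isRj_RkOfRecord hL2 θ.ν.r (gOfRecord₁₃ F N θ p p.K)
  have hRreal : (R : ℝ) ≤ 2 * (F.L : ℝ) ^ F.m := by exact_mod_cast hR
  -- the window: `log g_K⁻² > 2 · L^m ≥ 2`
  set T : ℝ := (F.L : ℝ) ^ F.m with hT
  have hT1 : 1 ≤ T := one_le_pow₀ (by exact_mod_cast (by omega : 1 ≤ F.L))
  obtain ⟨hg, hgγ⟩ := hW p.K le_rfl
  have hglt : gOfRecord₁₃ F N θ p p.K < Real.exp (-T) := lt_of_le_of_lt hgγ hγ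
  have hsq : gOfRecord₁₃ F N θ p p.K ^ 2 < Real.exp (-(2 * T)) := by
    have h1 : gOfRecord₁₃ F N θ p p.K ^ 2 < Real.exp (-T) ^ 2 := by gcongr
    have h2 : Real.exp (-T) ^ 2 = Real.exp (-(2 * T)) := by
      rw [sq, ← Real.exp_add]
      congr 1
      ring
    rwa [h2] at h1
  have hpos2 : 0 < gOfRecord₁₃ F N θ p p.K ^ 2 := by positivity
  have hinv : Real.exp (2 * T) < (gOfRecord₁₃ F N θ p p.K ^ 2)⁻¹ := by
    have h1 := one_div_lt_one_div_of_lt hpos2 hsq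
    rwa [one_div, one_div, Real.exp_neg, inv_inv] at h1
  have hlog : 2 * T < Real.log (gOfRecord₁₃ F N θ p p.K ^ 2)⁻¹ := by
    have h1 := Real.log_lt_log (Real.exp_pos _) hinv
    rwa [Real.log_exp] at h1
  have hone : 1 ≤ Real.log (gOfRecord₁₃ F N θ p p.K ^ 2)⁻¹ := by linarith
  have hself : Real.log (gOfRecord₁₃ F N θ p p.K ^ 2)⁻¹ ≤ (Real.log (gOfRecord₁₃ F N θ p p.K ^ 2)⁻¹) ^ θ.ν.r :=
    le_self_pow₀ hone (by omega)
  linarith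

/-- **LOCATED-r — AT `r = 0` THE GUARD IS FREE**: (2.5) with exponent `r = 0` gives `R_j = 1` for every coupling (`(log g_j⁻²)^0 = 1 ≤ L^0`), so at `θ.τ9.M = F.L^a`, `θ.ν.r = 0`
EVERY run is partition-compatible up to every `n` with room `n + a ≤ m + K` — no window, no floor.  Every witness of record has `r = 1`; `r = 0` would dodge the guard the way `4 ∣ M`
dodges row P11 (`…Record13SepInhabited/Negative/PartCompatDodge`), at the price of (2.5)'s growth `R_j ≥ (log g_j⁻²)^r`, `r ≥ 1`, which print's small-field decay uses.  Count-neutral.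
[cite: Balaban1988Convergent, (2.5) p.255, (2.1) p.254, p.257] -/
theorem partCompat₁₃_of_r_eq_zero (θ : Stage13Params F N) {a : ℕ} (hM : θ.τ9.M = F.L ^ a) (hr : θ.ν.r = 0) (p : B12.RunParams) {n : ℕ}
    (hn : n + a ≤ F.m + p.K) : PartCompat₁₃ F N θ p n :=
  partCompat₁₃_of_log_pow_le θ hM p n (fun _ => 0) (fun i _ hi => by omega) fun i _ _ => by
    rw [hr, pow_zero, pow_zero, Nat.cast_one]

end Generic

/-! ## §2  The consequent BODY of the crux at `(θ, h)` forces the §2 form at an incompatible run -/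

section Body

variable {F : T4Family} {N : ℕ} [NeZero N]

/-- **★★★ THE CRUX's CONSEQUENT AT `(θ, h)` ⇒ THE RECORD's §2 FORM AT A RUN WHOSE LAST 𝐃-CUBE DOES NOT FIT THE TORUS** (θ : Stage13HParams F N, `1 ≤ θ.ν.r`; `1 ≤ M` comes with
admissibility): from `(unity ∧ slots) ∧ Admissible ∧ B16.EndStatementBPrinted (datum θ h).C ∧ (∃ γ₁ > 0, ∀ γ ∈ ]0, γ₁], ∃ P, 1 ≤ P.K ∧ window γ P)` there is a run `P` of positive length,
NOT `PartCompat₁₃` at `P.K`, along which the record's `Sect2Form k` holds for every `k ≤ P.K` (take `γ := min (min γ₁ γ₂) (e^{−L^m}∕2)`, `γ₂` the printed window of `Thm1Printed`).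
β-free; LOCATED, count-neutral. [cite: Balaban1989LargeFieldII, Thm 1 p.355; Balaban1988Convergent, Thm 1 p.262, (2.5) p.255, p.257; Balaban1987RG1, Thm 1 p.259] -/
theorem exists_incompatible_run_with_sect2Form_of_consequentBody (θ : Stage13HParams F N) (h : θ.Provisos₁₃SepCoPH F N) (hr : 1 ≤ θ.ν.r)
    (hbody : (θ.ZhUnity F N ∧ θ.SlotsNondegenerate₁₃ F N) ∧ θ.Admissible F N ∧ B16.EndStatementBPrinted (datumOfRecord₁₃SepCoPH F N θ h).C ∧
      ∃ γ₁ : ℝ, 0 < γ₁ ∧ ∀ γ : ℝ, 0 < γ → γ ≤ γ₁ → ∃ P : B12.RunParams, 1 ≤ P.K ∧ ((datumOfRecord₁₃SepCoPH F N θ h).C P).flow.InInterval γ P.K) :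
    ∃ P : B12.RunParams, 1 ≤ P.K ∧ ¬ PartCompat₁₃ F N θ.toStage13Params P P.K ∧
      ∀ k, k ≤ P.K → ((datumOfRecord₁₃SepCoPH F N θ h).C P).Sect2Form k := by
  obtain ⟨-, hθ, ⟨⟨γ₂, hγ₂, hS⟩, -⟩, γ₁, hγ₁, hwin⟩ := hbody
  have hM : 1 ≤ θ.τ9.M := hθ.toStage9.2.2.2
  have hexp : 0 < Real.exp (-((F.L : ℝ) ^ F.m)) := Real.exp_pos _
  set γ : ℝ := min (min γ₁ γ₂) (Real.exp (-((F.L : ℝ) ^ F.m)) / 2) with hγdef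
  have hγpos : 0 < γ := lt_min (lt_min hγ₁ hγ₂) (by linarith)
  have hγ1 : γ ≤ γ₁ := (min_le_left _ _).trans (min_le_left _ _)
  have hγ2 : γ ≤ γ₂ := (min_le_left _ _).trans (min_le_right _ _)
  have hγt : γ < Real.exp (-((F.L : ℝ) ^ F.m)) := by
    have := min_le_right (min γ₁ γ₂) (Real.exp (-((F.L : ℝ) ^ F.m)) / 2)
    linarith
  obtain ⟨P, hK, hW⟩ := hwin γ hγpos hγ1
  refine ⟨P, hK, ?_, fun k hk => hS P (fun j hj => ⟨(hW j hj).1, (hW j hj).2.trans hγ2⟩) k hk⟩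
  exact not_partCompat₁₃_top_of_window_lt_exp_neg_pow θ.toStage13Params hM hr P hK (fun j hj => hW j hj) hγt

end Body

/-! ## §3  The ROUTE DECL BY NAME, as a hypothesis: K1⁷ ⇒ the §2 form at an incompatible run of the θ it produces -/

section Crux

/-- **★★★ WHAT ANY PROOF OF K1⁷ DELIVERS** (the crux `Summit.QuantumFields.YangMills.Theses.BalabanUVNodes.StabilityBAtRecordR13SepCoPH` as HYPOTHESIS, type literally): for every family
`F` with a unity Stage-13 tuple, the `(θ, h)` the crux produces is admissible, carries `B16.EndStatementBPrinted (datum θ h).C`, AND — whenever `1 ≤ θ.ν.r` ((2.5)'s exponent; `r = 1`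
at every witness of record) — a run `P` of positive length whose LAST 𝐃-CUBE DOES NOT FIT THE TORUS (`¬ PartCompat₁₃ θ P P.K`) along which the record's §2 form holds at every level.
So K1⁷ asserts [III] Thm 1's conclusion for the record OUTSIDE print's standing assumption «all partitions are compatible» (p. 257).  LOCATED, count-neutral; the crux is neither proved
nor refuted here. [cite: Balaban1989LargeFieldII, Thm 1 p.355; Balaban1988Convergent, Thm 1 p.262, (2.1) p.254, (2.5) p.255, p.257; Balaban1987RG1, Thm 1 p.259] -/
theorem incompatibleRun_of_stabilityBAtRecordR13SepCoPH (hK1 : Summit.QuantumFields.YangMills.Theses.BalabanUVNodes.StabilityBAtRecordR13SepCoPH)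
    (F : T4Family) (hinh : ∃ θ : Stage13HParams F 2, θ.Provisos₁₃SepCoPH F 2 ∧ (θ.ZhUnity F 2 ∧ θ.SlotsNondegenerate₁₃ F 2) ∧ θ.Admissible F 2) :
    ∃ (θ : Stage13HParams F 2) (h : θ.Provisos₁₃SepCoPH F 2), θ.Admissible F 2 ∧ B16.EndStatementBPrinted (datumOfRecord₁₃SepCoPH F 2 θ h).C ∧
      (1 ≤ θ.ν.r → ∃ P : B12.RunParams, 1 ≤ P.K ∧ ¬ PartCompat₁₃ F 2 θ.toStage13Params P P.K ∧
        ∀ k, k ≤ P.K → ((datumOfRecord₁₃SepCoPH F 2 θ h).C P).Sect2Form k) := by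
  obtain ⟨θ, h, hbody⟩ := hK1 F hinh
  exact ⟨θ, h, hbody.2.1, hbody.2.2.1, fun hr => exists_incompatible_run_with_sect2Form_of_consequentBody θ h hr hbody⟩

end Crux

end Summit.QuantumFields.YangMills.Theorems.BalabanUVNodesN11K1ConsequentMeetsIncompatibleRuns

end
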